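import Summits.FinalStateConjecture.FinalStateConjecture.Theses.LogTimeThreeAnnuli
import Summits.FinalStateConjecture.FinalStateConjecture.Theses.ExactKerrEnds
import Literature.Geometry.Lorentzian.TameGenericityDiagonal
import Literature.Geometry.Lorentzian.ExactKerrEnd
import HarnessLib

/-!
# Crux `LogTimeThreeAnnuli.SubconvergentEraGeneric` (stmt-FinalStateConjecture-17490) ALONG KERR ENDS:
# the crux from `ExactKerrEnds.TameEscapeToKerrEnds` (stmt-18522), `ExactKerrEnds.CensorshipAlongKerrEnds`
# (stmt-18521) and the residual "subconvergent era along censored Kerr-ended curves" — and the converse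

The composition half of the RESHAPED birth skeleton `Cruxes/SubconvergentEraGeneric/Lines/birth.lean` (lead c3,
2026-08-17), landed as a `--supports` piece of stmt-FinalStateConjecture-17490 (registered structural sub-goals, same
names).  The crux and the two `ExactKerrEnds` items are referred to BY NAME (this module imports both Theses files; an
eventual closing file of 17490 — which may not import `Theses.LogTimeThreeAnnuli` — redoes the ten-line composition
from the Literature lemmas instead of importing this one):

* `subconvergentEraGeneric_of_alongCensoredKerrEnds : E → C₁ → C₂' → SubconvergentEraGeneric`, where
  - E  = `Theses.ExactKerrEnds.TameEscapeToKerrEnds` (item stmt-FinalStateConjecture-18522): Kerr-endedness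
    (`InitialDataSet.HasExactKerrEnd`, verbatim that route's let-bound legend) is tame-Christodoulou-generic;
  - C₁ = `Theses.ExactKerrEnds.CensorshipAlongKerrEnds` (item stmt-FinalStateConjecture-18521): along every tame curve of
    admissible data, immersed-injective or constant, whose members off `0` are Kerr-ended there is a tame injective
    immersed admissible curve through the same base datum whose members off `0` are Kerr-ended AND censored;
  - C₂' (the registered stub `stub_subconvergentEraAlongCensoredKerrEnds` of the skeleton, INLINED): along every such
    curve whose members off `0` are Kerr-ended and censored AND whose base datum is EXCEPTIONAL for the crux's property
    `P` ("every MGHD has complete `𝓘⁺` and carries an honest all-`k` windowed boosted subconvergent final era", covector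
    orientation gauge; window background as the anonymous constructor `⟨domain, boostedKerrBilin …, time, radius⟩`,
    definitionally the route decl's `{d.background i with bilin := …}`), there is a tame injective immersed admissible
    curve through the same base datum whose members off `0` satisfy `P`.
  Proof: every admissible datum has a sole Dafermos–Rodnianski end (constant curves are tame);
  `InitialDataSet.isTameChristodoulouGeneric_of_relative'` (E, C₁) makes "Kerr-ended ∧ censored" tame-generic;
  `InitialDataSet.isTameChristodoulouGeneric_of_relative_exceptional` (C₂') makes `P` tame-generic — the route decl.
* `alongCensoredKerrEnds_of_subconvergentEraGeneric : SubconvergentEraGeneric → C₂'` — UNCONDITIONALLY: C₂' asks for a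
  `P`-curve only through an admissible base datum exceptional for `P`, which is tame genericity of `P` read there
  (`InitialDataSet.exists_curve_of_isTameChristodoulouGeneric_of_not`).  Hence
* `subconvergentEraGeneric_iff_alongCensoredKerrEnds : E → C₁ → (SubconvergentEraGeneric ↔ C₂')`: modulo the two
  `ExactKerrEnds` items the crux IS the residual C₂' — the reshape loses nothing and adds nothing; what it buys is the
  SHAPE of the residual (only Kerr-ended censored members, so weak cosmic censorship and the rough-tail /
  far-annulus-gluing escape forced by the all-`k` clauses against `o₂` admissible tails are factored OUT into existing
  items; only exceptional base data, so no stability demand at good data).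

No analysis is claimed; E, C₁, C₂' stay OPEN and this file credits nothing towards them.
Sources: Christodoulou, CQG 16 (1999) A23, p. A24 (genericity by positive codimension; lines `α₀ + c f`);
Corvino–Schoen, J. Diff. Geom. 73 (2006) 185, Thm. 4 (Kerr-ended data); Dafermos–Luk arXiv:1710.01722 §1.2.1.
-/


noncomputable section

-- the doubled `FinalStateConjecture` path component is the summit/problem naming scheme
set_option linter.dupNamespace false

namespace Summit.FinalStateConjecture.FinalStateConjecture.Theorems.LogTimeThreeAnnuli.SubconvergentEraGeneric

open scoped Manifold ContDiff Topology ENNReal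
open Filter Set Function Literature.Geometry.Lorentzian
open Summit.FinalStateConjecture (HasCompleteNullInfinity exteriorOf RaysStayInClosure IsOrthochronous)
open Literature.Geometry.Lorentzian.InitialDataSet (IsTameDataFamily IsImmersedAtZero IsTameChristodoulouGeneric)
open Summit.FinalStateConjecture.FinalStateConjecture.Theses.LogTimeThreeAnnuli (SubconvergentEraGeneric)
open Summit.FinalStateConjecture.FinalStateConjecture.Theses.ExactKerrEnds (TameEscapeToKerrEnds CensorshipAlongKerrEnds)

/-- **The crux from E, C₁ and C₂' (composition along curves).**  Hypotheses: item stmt-18522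
`Theses.ExactKerrEnds.TameEscapeToKerrEnds` and item stmt-18521 `Theses.ExactKerrEnds.CensorshipAlongKerrEnds`, by name;
the registered stub C₂' (subconvergent era produced along censored Kerr-ended tame curves through base data exceptional
for the crux's property), inlined.  Conclusion: the route decl `Theses.LogTimeThreeAnnuli.SubconvergentEraGeneric`, by
name (its `with`-update window background and the stub's anonymous constructor are the same term).  Proof:
`isTameChristodoulouGeneric_of_relative'` then `isTameChristodoulouGeneric_of_relative_exceptional`.
Christodoulou, CQG 16 (1999) A23, p. A24. [cite: Christodoulou1999, p. A24] -/
theorem subconvergentEraGeneric_of_alongCensoredKerrEnds : TameEscapeToKerrEnds → CensorshipAlongKerrEnds → (∀ (X : Type) [TopologicalSpace X] [ChartedSpace E3 X] [IsManifold (𝓡 3) ∞ X] [T2Space X] [SecondCountableTopology X] [ConnectedSpace X], ∀ (e : AFEnd X) (F : EuclideanSpace ℝ (Fin 1) → InitialDataSet (𝓡 3) X), IsTameDataFamily e 1 F → ((IsImmersedAtZero 1 F ∧ Injective F) ∨ ∀ c, F c = F 0) → (∀ c, F c ∈ admissibleVacuumData X) → (∀ c ≠ 0, (F c).HasExactKerrEnd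 ∧ ∀ 𝒟 : VacuumCauchyDevelopment (F c), 𝒟.IsMaximal → HasCompleteNullInfinity 𝒟.toCauchyDevelopment) → ¬ (∀ 𝒟 : VacuumCauchyDevelopment (F 0), 𝒟.IsMaximal → HasCompleteNullInfinity 𝒟.toCauchyDevelopment ∧ (∃ (m₀ χ : ℝ) (O : Set 𝒟.carrier) (d : QuasiFinalStateDecomposition 𝒟.toSpacetime O 2 ⊤) (R : Fin d.N → ℝ → ℝ), 0 < m₀ ∧ χ < 1 ∧ O = exteriorOf 𝒟.toCauchyDevelopment d.charted ∧ RaysStayInClosure 𝒟.toCauchyDevelopment O ∧ (∀ i, Tendsto (R i) atTop atTop ∧ ∀ τ, max (Kerr.rPlus (d.mass i) (d.spin i)) 0 + 1 ≤ R i τ) ∧ (∀ τ₁, d.τ₀ < τ₁ → O \ d.certifiedLate R τ₁ ⊆ 𝒟.metric.causalPast 𝒟.timeOrientation (d.certifiedSlab R τ₁)) ∧ (∀ i, IsOrthochronous (d.motion i).1) ∧ (∀ i (ρ : ℝ), ∀ᶠ τ in atTop, ∀ x ∈ (d.background i).truncTimeSlab ρ τ, ∀ w : E4, 𝒟.timeOrientation.IsFutureDirected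 (mfderiv 𝓘(ℝ, E4) (𝓡 4) (d.chart i) x w) → 0 < ((d.motion i).1 : E4 ≃L[ℝ] E4).symm w 0) ∧ (∀ᶠ τ in atTop, ∀ x ∈ (Minkowski.backgroundOn d.flatDomain).timeSlab τ, 𝒟.timeOrientation.IsFutureDirected (mfderiv 𝓘(ℝ, E4) (𝓡 4) d.flatChart x (E4.basisVector 0))) ∧ (∀ k, Tendsto (fun τ => 𝒟.toSpacetime.deviationCk (Minkowski.backgroundOn d.flatDomain) d.flatChart k τ) atTop (𝓝 0)) ∧ (∀ i k (ρ : ℝ) (ε : ℝ≥0∞), 0 < ε → ∀ᶠ τ in atTop, ∃ M a, m₀ ≤ M ∧ M ≤ m₀⁻¹ ∧ |a| ≤ χ * M ∧ 𝒟.toSpacetime.truncDeviationCk ⟨(d.background i).domain, boostedKerrBilin (d.motion i).1 (d.motion i).2 M a, (d.background i).time, (d.background i).radius⟩ (d.chart i) k ρ τ ≤ ε ∧ 𝒟.toSpacetime.truncDeviationCk ⟨(d.background i).domain, boostedKerrBilin (d.motion i).1 (d.motion i).2 M a, (d.background i).time, (d.background i).radius⟩ (d.chart i) k (R i τ) τ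 ≤ ε))) → ∃ (e' : AFEnd X) (F' : EuclideanSpace ℝ (Fin 1) → InitialDataSet (𝓡 3) X), IsTameDataFamily e' 1 F' ∧ F' 0 = F 0 ∧ Injective F' ∧ IsImmersedAtZero 1 F' ∧ (∀ c, F' c ∈ admissibleVacuumData X) ∧ ∀ c ≠ 0, ∀ 𝒟 : VacuumCauchyDevelopment (F' c), 𝒟.IsMaximal → HasCompleteNullInfinity 𝒟.toCauchyDevelopment ∧ (∃ (m₀ χ : ℝ) (O : Set 𝒟.carrier) (d : QuasiFinalStateDecomposition 𝒟.toSpacetime O 2 ⊤) (R : Fin d.N → ℝ → ℝ), 0 < m₀ ∧ χ < 1 ∧ O = exteriorOf 𝒟.toCauchyDevelopment d.charted ∧ RaysStayInClosure 𝒟.toCauchyDevelopment O ∧ (∀ i, Tendsto (R i) atTop atTop ∧ ∀ τ, max (Kerr.rPlus (d.mass i) (d.spin i)) 0 + 1 ≤ R i τ) ∧ (∀ τ₁, d.τ₀ < τ₁ → O \ d.certifiedLate R τ₁ ⊆ 𝒟.metric.causalPast 𝒟.timeOrientation (d.certifiedSlab R τ₁)) ∧ (∀ i, IsOrthochronous (d.motion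 i).1) ∧ (∀ i (ρ : ℝ), ∀ᶠ τ in atTop, ∀ x ∈ (d.background i).truncTimeSlab ρ τ, ∀ w : E4, 𝒟.timeOrientation.IsFutureDirected (mfderiv 𝓘(ℝ, E4) (𝓡 4) (d.chart i) x w) → 0 < ((d.motion i).1 : E4 ≃L[ℝ] E4).symm w 0) ∧ (∀ᶠ τ in atTop, ∀ x ∈ (Minkowski.backgroundOn d.flatDomain).timeSlab τ, 𝒟.timeOrientation.IsFutureDirected (mfderiv 𝓘(ℝ, E4) (𝓡 4) d.flatChart x (E4.basisVector 0))) ∧ (∀ k, Tendsto (fun τ => 𝒟.toSpacetime.deviationCk (Minkowski.backgroundOn d.flatDomain) d.flatChart k τ) atTop (𝓝 0)) ∧ (∀ i k (ρ : ℝ) (ε : ℝ≥0∞), 0 < ε → ∀ᶠ τ in atTop, ∃ M a, m₀ ≤ M ∧ M ≤ m₀⁻¹ ∧ |a| ≤ χ * M ∧ 𝒟.toSpacetime.truncDeviationCk ⟨(d.background i).domain, boostedKerrBilin (d.motion i).1 (d.motion i).2 M a, (d.background i).time, (d.background i).radius⟩ (d.chart i) k ρ τ ≤ ε ∧ 𝒟.toSpacetime.truncDeviationCk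 ⟨(d.background i).domain, boostedKerrBilin (d.motion i).1 (d.motion i).2 M a, (d.background i).time, (d.background i).radius⟩ (d.chart i) k (R i τ) τ ≤ ε))) → SubconvergentEraGeneric := by
  intro hE hC hS X _ _ _ _ _ _
  -- every admissible datum has a sole, strongly asymptotically flat end (constant curves are tame)
  have h𝓓 : ∀ d ∈ admissibleVacuumData X, ∃ e : AFEnd X, e.IsSoleEnd ∧
      ∃ M : ℝ, e.IsStronglyAsymptoticallyFlatDR d M :=
    fun d hd => exists_isSoleEnd_of_mem_admissibleVacuumData hd
  -- step 1 (E, C₁): "Kerr-ended ∧ censored" is tame-generic, by composition along curves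
  have h1 : Literature.Geometry.Lorentzian.InitialDataSet.IsTameChristodoulouGeneric
      (Literature.Geometry.Lorentzian.admissibleVacuumData X)
      (fun D ↦ (fun D ↦ ∀ [Literature.Geometry.Lorentzian.Kerr.Facts], ∃ (K : Set X) (U : TopologicalSpace.Opens Literature.Geometry.Lorentzian.E3) (M a r₀ : ℝ) (hM : 0 ≤ M) (φ : U → X) (ψ : U → Literature.Geometry.Lorentzian.Kerr.region a r₀) (ν : Literature.Geometry.Lorentzian.NormalField 𝓘(ℝ, Literature.Geometry.Lorentzian.E4) ψ), IsCompact K ∧ Kᶜ ⊆ range φ ∧ Topology.IsOpenEmbedding φ ∧ ContMDiff 𝓘(ℝ, Literature.Geometry.Lorentzian.E3) (𝓡 3) ((⊤ : ℕ∞) : WithTop ℕ∞) φ ∧ Injective ψ ∧ (Literature.Geometry.Lorentzian.Kerr.smoothMetric M a r₀).IsSpacelikeImmersion 𝓘(ℝ, Literature.Geometry.Lorentzian.E3) ψ ∧ (Literature.Geometry.Lorentzian.Kerr.smoothMetric M a r₀).IsFutureUnitNormal 𝓘(ℝ, Literature.Geometry.Lorentzian.E3) ((Literature.Geometry.Lorentzian.Kerr.timeOrientation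 M a r₀ hM).ofLE le_top) ψ ν ∧ (∀ (y : U) (v w : Literature.Geometry.Lorentzian.E3), φ y ∉ K → D.h.inner (φ y) (mfderiv 𝓘(ℝ, Literature.Geometry.Lorentzian.E3) (𝓡 3) φ y v) (mfderiv 𝓘(ℝ, Literature.Geometry.Lorentzian.E3) (𝓡 3) φ y w) = Literature.Geometry.Lorentzian.Kerr.bilin M a (ψ y : Literature.Geometry.Lorentzian.E4) (mfderiv 𝓘(ℝ, Literature.Geometry.Lorentzian.E3) 𝓘(ℝ, Literature.Geometry.Lorentzian.E4) ψ y v) (mfderiv 𝓘(ℝ, Literature.Geometry.Lorentzian.E3) 𝓘(ℝ, Literature.Geometry.Lorentzian.E4) ψ y w)) ∧ (∀ [(Literature.Geometry.Lorentzian.Kerr.smoothMetric M a r₀).HasLeviCivita] (y : U) (v w : Literature.Geometry.Lorentzian.E3), φ y ∉ K → D.k (φ y) (mfderiv 𝓘(ℝ, Literature.Geometry.Lorentzian.E3) (𝓡 3) φ y v) (mfderiv 𝓘(ℝ, Literature.Geometry.Lorentzian.E3) (𝓡 3) φ y w) = (Literature.Geometry.Lorentzian.Kerr.smoothMetric M a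 r₀).secondFundamentalForm 𝓘(ℝ, Literature.Geometry.Lorentzian.E3) ψ ν y v w)) D ∧ (fun D ↦ ∀ 𝒟 : Literature.Geometry.Lorentzian.VacuumCauchyDevelopment D, 𝒟.IsMaximal → Summit.FinalStateConjecture.HasCompleteNullInfinity 𝒟.toCauchyDevelopment) D) 1 :=
    InitialDataSet.isTameChristodoulouGeneric_of_relative' h𝓓 (hE X) (hC X)
  -- step 2 (C₂'): the crux's property, handed back along censored Kerr-ended curves through exceptional base data
  exact InitialDataSet.isTameChristodoulouGeneric_of_relative_exceptional h𝓓 h1 (hS X)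

/-- **The crux implies C₂'**, unconditionally: tame genericity of the crux's property, read at the (admissible,
exceptional) base datum of the incoming curve, is exactly the hand-back C₂' asks for; the Kerr-ended / censored
hypotheses on the incoming curve are not used.  [folklore] -/
theorem alongCensoredKerrEnds_of_subconvergentEraGeneric : SubconvergentEraGeneric → ∀ (X : Type) [TopologicalSpace X] [ChartedSpace E3 X] [IsManifold (𝓡 3) ∞ X] [T2Space X] [SecondCountableTopology X] [ConnectedSpace X], ∀ (e : AFEnd X) (F : EuclideanSpace ℝ (Fin 1) → InitialDataSet (𝓡 3) X), IsTameDataFamily e 1 F → ((IsImmersedAtZero 1 F ∧ Injective F) ∨ ∀ c, F c = F 0) → (∀ c, F c ∈ admissibleVacuumData X) → (∀ c ≠ 0, (F c).HasExactKerrEnd ∧ ∀ 𝒟 : VacuumCauchyDevelopment (F c), 𝒟.IsMaximal → HasCompleteNullInfinity 𝒟.toCauchyDevelopment) → ¬ (∀ 𝒟 : VacuumCauchyDevelopment (F 0), 𝒟.IsMaximal → HasCompleteNullInfinity 𝒟.toCauchyDevelopment ∧ (∃ (m₀ χ : ℝ) (O : Set 𝒟.carrier) (d : QuasiFinalStateDecomposition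 𝒟.toSpacetime O 2 ⊤) (R : Fin d.N → ℝ → ℝ), 0 < m₀ ∧ χ < 1 ∧ O = exteriorOf 𝒟.toCauchyDevelopment d.charted ∧ RaysStayInClosure 𝒟.toCauchyDevelopment O ∧ (∀ i, Tendsto (R i) atTop atTop ∧ ∀ τ, max (Kerr.rPlus (d.mass i) (d.spin i)) 0 + 1 ≤ R i τ) ∧ (∀ τ₁, d.τ₀ < τ₁ → O \ d.certifiedLate R τ₁ ⊆ 𝒟.metric.causalPast 𝒟.timeOrientation (d.certifiedSlab R τ₁)) ∧ (∀ i, IsOrthochronous (d.motion i).1) ∧ (∀ i (ρ : ℝ), ∀ᶠ τ in atTop, ∀ x ∈ (d.background i).truncTimeSlab ρ τ, ∀ w : E4, 𝒟.timeOrientation.IsFutureDirected (mfderiv 𝓘(ℝ, E4) (𝓡 4) (d.chart i) x w) → 0 < ((d.motion i).1 : E4 ≃L[ℝ] E4).symm w 0) ∧ (∀ᶠ τ in atTop, ∀ x ∈ (Minkowski.backgroundOn d.flatDomain).timeSlab τ, 𝒟.timeOrientation.IsFutureDirected (mfderiv 𝓘(ℝ, E4) (𝓡 4) d.flatChart x (E4.basisVector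 0))) ∧ (∀ k, Tendsto (fun τ => 𝒟.toSpacetime.deviationCk (Minkowski.backgroundOn d.flatDomain) d.flatChart k τ) atTop (𝓝 0)) ∧ (∀ i k (ρ : ℝ) (ε : ℝ≥0∞), 0 < ε → ∀ᶠ τ in atTop, ∃ M a, m₀ ≤ M ∧ M ≤ m₀⁻¹ ∧ |a| ≤ χ * M ∧ 𝒟.toSpacetime.truncDeviationCk ⟨(d.background i).domain, boostedKerrBilin (d.motion i).1 (d.motion i).2 M a, (d.background i).time, (d.background i).radius⟩ (d.chart i) k ρ τ ≤ ε ∧ 𝒟.toSpacetime.truncDeviationCk ⟨(d.background i).domain, boostedKerrBilin (d.motion i).1 (d.motion i).2 M a, (d.background i).time, (d.background i).radius⟩ (d.chart i) k (R i τ) τ ≤ ε))) → ∃ (e' : AFEnd X) (F' : EuclideanSpace ℝ (Fin 1) → InitialDataSet (𝓡 3) X), IsTameDataFamily e' 1 F' ∧ F' 0 = F 0 ∧ Injective F' ∧ IsImmersedAtZero 1 F' ∧ (∀ c, F' c ∈ admissibleVacuumData X) ∧ ∀ c ≠ 0, ∀ 𝒟 : VacuumCauchyDevelopment (F' c), 𝒟.IsMaximal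 → HasCompleteNullInfinity 𝒟.toCauchyDevelopment ∧ (∃ (m₀ χ : ℝ) (O : Set 𝒟.carrier) (d : QuasiFinalStateDecomposition 𝒟.toSpacetime O 2 ⊤) (R : Fin d.N → ℝ → ℝ), 0 < m₀ ∧ χ < 1 ∧ O = exteriorOf 𝒟.toCauchyDevelopment d.charted ∧ RaysStayInClosure 𝒟.toCauchyDevelopment O ∧ (∀ i, Tendsto (R i) atTop atTop ∧ ∀ τ, max (Kerr.rPlus (d.mass i) (d.spin i)) 0 + 1 ≤ R i τ) ∧ (∀ τ₁, d.τ₀ < τ₁ → O \ d.certifiedLate R τ₁ ⊆ 𝒟.metric.causalPast 𝒟.timeOrientation (d.certifiedSlab R τ₁)) ∧ (∀ i, IsOrthochronous (d.motion i).1) ∧ (∀ i (ρ : ℝ), ∀ᶠ τ in atTop, ∀ x ∈ (d.background i).truncTimeSlab ρ τ, ∀ w : E4, 𝒟.timeOrientation.IsFutureDirected (mfderiv 𝓘(ℝ, E4) (𝓡 4) (d.chart i) x w) → 0 < ((d.motion i).1 : E4 ≃L[ℝ] E4).symm w 0) ∧ (∀ᶠ τ in atTop, ∀ x ∈ (Minkowski.backgroundOn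 d.flatDomain).timeSlab τ, 𝒟.timeOrientation.IsFutureDirected (mfderiv 𝓘(ℝ, E4) (𝓡 4) d.flatChart x (E4.basisVector 0))) ∧ (∀ k, Tendsto (fun τ => 𝒟.toSpacetime.deviationCk (Minkowski.backgroundOn d.flatDomain) d.flatChart k τ) atTop (𝓝 0)) ∧ (∀ i k (ρ : ℝ) (ε : ℝ≥0∞), 0 < ε → ∀ᶠ τ in atTop, ∃ M a, m₀ ≤ M ∧ M ≤ m₀⁻¹ ∧ |a| ≤ χ * M ∧ 𝒟.toSpacetime.truncDeviationCk ⟨(d.background i).domain, boostedKerrBilin (d.motion i).1 (d.motion i).2 M a, (d.background i).time, (d.background i).radius⟩ (d.chart i) k ρ τ ≤ ε ∧ 𝒟.toSpacetime.truncDeviationCk ⟨(d.background i).domain, boostedKerrBilin (d.motion i).1 (d.motion i).2 M a, (d.background i).time, (d.background i).radius⟩ (d.chart i) k (R i τ) τ ≤ ε)) := by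
  intro h X _ _ _ _ _ _ e F hF hdich hF𝓓 hQ hexc
  exact InitialDataSet.exists_curve_of_isTameChristodoulouGeneric_of_not
    (Q := fun D => D.HasExactKerrEnd ∧
      ∀ 𝒟 : VacuumCauchyDevelopment D, 𝒟.IsMaximal → HasCompleteNullInfinity 𝒟.toCauchyDevelopment)
    (h X) e F hF hdich hF𝓓 hQ hexc

/-- **Modulo the two `ExactKerrEnds` items, the crux IS the residual C₂'.**  [folklore] -/
theorem subconvergentEraGeneric_iff_alongCensoredKerrEnds : TameEscapeToKerrEnds → CensorshipAlongKerrEnds → (SubconvergentEraGeneric ↔ (∀ (X : Type) [TopologicalSpace X] [ChartedSpace E3 X] [IsManifold (𝓡 3) ∞ X] [T2Space X] [SecondCountableTopology X] [ConnectedSpace X], ∀ (e : AFEnd X) (F : EuclideanSpace ℝ (Fin 1) → InitialDataSet (𝓡 3) X), IsTameDataFamily e 1 F → ((IsImmersedAtZero 1 F ∧ Injective F) ∨ ∀ c, F c = F 0) → (∀ c, F c ∈ admissibleVacuumData X) → (∀ c ≠ 0, (F c).HasExactKerrEnd ∧ ∀ 𝒟 : VacuumCauchyDevelopment (F c), 𝒟.IsMaximal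 → HasCompleteNullInfinity 𝒟.toCauchyDevelopment) → ¬ (∀ 𝒟 : VacuumCauchyDevelopment (F 0), 𝒟.IsMaximal → HasCompleteNullInfinity 𝒟.toCauchyDevelopment ∧ (∃ (m₀ χ : ℝ) (O : Set 𝒟.carrier) (d : QuasiFinalStateDecomposition 𝒟.toSpacetime O 2 ⊤) (R : Fin d.N → ℝ → ℝ), 0 < m₀ ∧ χ < 1 ∧ O = exteriorOf 𝒟.toCauchyDevelopment d.charted ∧ RaysStayInClosure 𝒟.toCauchyDevelopment O ∧ (∀ i, Tendsto (R i) atTop atTop ∧ ∀ τ, max (Kerr.rPlus (d.mass i) (d.spin i)) 0 + 1 ≤ R i τ) ∧ (∀ τ₁, d.τ₀ < τ₁ → O \ d.certifiedLate R τ₁ ⊆ 𝒟.metric.causalPast 𝒟.timeOrientation (d.certifiedSlab R τ₁)) ∧ (∀ i, IsOrthochronous (d.motion i).1) ∧ (∀ i (ρ : ℝ), ∀ᶠ τ in atTop, ∀ x ∈ (d.background i).truncTimeSlab ρ τ, ∀ w : E4, 𝒟.timeOrientation.IsFutureDirected (mfderiv 𝓘(ℝ, E4) (𝓡 4) (d.chart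 i) x w) → 0 < ((d.motion i).1 : E4 ≃L[ℝ] E4).symm w 0) ∧ (∀ᶠ τ in atTop, ∀ x ∈ (Minkowski.backgroundOn d.flatDomain).timeSlab τ, 𝒟.timeOrientation.IsFutureDirected (mfderiv 𝓘(ℝ, E4) (𝓡 4) d.flatChart x (E4.basisVector 0))) ∧ (∀ k, Tendsto (fun τ => 𝒟.toSpacetime.deviationCk (Minkowski.backgroundOn d.flatDomain) d.flatChart k τ) atTop (𝓝 0)) ∧ (∀ i k (ρ : ℝ) (ε : ℝ≥0∞), 0 < ε → ∀ᶠ τ in atTop, ∃ M a, m₀ ≤ M ∧ M ≤ m₀⁻¹ ∧ |a| ≤ χ * M ∧ 𝒟.toSpacetime.truncDeviationCk ⟨(d.background i).domain, boostedKerrBilin (d.motion i).1 (d.motion i).2 M a, (d.background i).time, (d.background i).radius⟩ (d.chart i) k ρ τ ≤ ε ∧ 𝒟.toSpacetime.truncDeviationCk ⟨(d.background i).domain, boostedKerrBilin (d.motion i).1 (d.motion i).2 M a, (d.background i).time, (d.background i).radius⟩ (d.chart i) k (R i τ) τ ≤ ε))) → ∃ (e' : AFEnd X) (F' : EuclideanSpace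 ℝ (Fin 1) → InitialDataSet (𝓡 3) X), IsTameDataFamily e' 1 F' ∧ F' 0 = F 0 ∧ Injective F' ∧ IsImmersedAtZero 1 F' ∧ (∀ c, F' c ∈ admissibleVacuumData X) ∧ ∀ c ≠ 0, ∀ 𝒟 : VacuumCauchyDevelopment (F' c), 𝒟.IsMaximal → HasCompleteNullInfinity 𝒟.toCauchyDevelopment ∧ (∃ (m₀ χ : ℝ) (O : Set 𝒟.carrier) (d : QuasiFinalStateDecomposition 𝒟.toSpacetime O 2 ⊤) (R : Fin d.N → ℝ → ℝ), 0 < m₀ ∧ χ < 1 ∧ O = exteriorOf 𝒟.toCauchyDevelopment d.charted ∧ RaysStayInClosure 𝒟.toCauchyDevelopment O ∧ (∀ i, Tendsto (R i) atTop atTop ∧ ∀ τ, max (Kerr.rPlus (d.mass i) (d.spin i)) 0 + 1 ≤ R i τ) ∧ (∀ τ₁, d.τ₀ < τ₁ → O \ d.certifiedLate R τ₁ ⊆ 𝒟.metric.causalPast 𝒟.timeOrientation (d.certifiedSlab R τ₁)) ∧ (∀ i, IsOrthochronous (d.motion i).1) ∧ (∀ i (ρ : ℝ), ∀ᶠ τ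 in atTop, ∀ x ∈ (d.background i).truncTimeSlab ρ τ, ∀ w : E4, 𝒟.timeOrientation.IsFutureDirected (mfderiv 𝓘(ℝ, E4) (𝓡 4) (d.chart i) x w) → 0 < ((d.motion i).1 : E4 ≃L[ℝ] E4).symm w 0) ∧ (∀ᶠ τ in atTop, ∀ x ∈ (Minkowski.backgroundOn d.flatDomain).timeSlab τ, 𝒟.timeOrientation.IsFutureDirected (mfderiv 𝓘(ℝ, E4) (𝓡 4) d.flatChart x (E4.basisVector 0))) ∧ (∀ k, Tendsto (fun τ => 𝒟.toSpacetime.deviationCk (Minkowski.backgroundOn d.flatDomain) d.flatChart k τ) atTop (𝓝 0)) ∧ (∀ i k (ρ : ℝ) (ε : ℝ≥0∞), 0 < ε → ∀ᶠ τ in atTop, ∃ M a, m₀ ≤ M ∧ M ≤ m₀⁻¹ ∧ |a| ≤ χ * M ∧ 𝒟.toSpacetime.truncDeviationCk ⟨(d.background i).domain, boostedKerrBilin (d.motion i).1 (d.motion i).2 M a, (d.background i).time, (d.background i).radius⟩ (d.chart i) k ρ τ ≤ ε ∧ 𝒟.toSpacetime.truncDeviationCk ⟨(d.background i).domain, boostedKerrBilin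 (d.motion i).1 (d.motion i).2 M a, (d.background i).time, (d.background i).radius⟩ (d.chart i) k (R i τ) τ ≤ ε)))) :=
  fun hE hC => ⟨alongCensoredKerrEnds_of_subconvergentEraGeneric, subconvergentEraGeneric_of_alongCensoredKerrEnds hE hC⟩

end Summit.FinalStateConjecture.FinalStateConjecture.Theorems.LogTimeThreeAnnuli.SubconvergentEraGeneric

end
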